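/-
Origin: expansion seat `planner-pub-hodgecm-pohl-g2-0`, handover 2026-08-18T03:57:00Z (`HOME/pub-hodgecm-pohl-g2/lean/Pohl2/CupPow.lean`, md5 c70419b4, 240 lines);
landed by the gen-5 packager in gate run 20 as `HodgeCM/Proofs/Pohlmann/CupPow.lean` (import ^import Pohl2\.CupFacts\b→import HodgeCM.Geometry.CupFacts ×1).
-/
/-
Copyright: pub-hodgecm formalisation cell (harness21, 2026). New file (not vendored).
Origin: HOME/pub-hodgecm-pohl-g2/lean/Pohl2/CupPow.lean — session planner-pub-hodgecm-pohl-g2-0 (unit pub-hodgecm-pohl-g2),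
part (b) `PohlmannSpan`, generation 2.  Intended final place: `HodgeCM/Proofs/Pohlmann/CupPow.lean`
(module `HodgeCM.Proofs.Pohlmann.CupPow`).  WIP imports `Pohl2.X` → `HodgeCM.Geometry.X`.
-/
import Summits.HodgeConjecture.HodgeCM.Geometry.CupFacts
import Summits.HodgeConjecture.HodgeCM.Proofs.Prop22.Basic
import Mathlib.LinearAlgebra.Multilinear.Basis
import Mathlib.LinearAlgebra.Multilinear.Curry
import Mathlib.RingTheory.TensorProduct.Free

/-!
# The complexified iterated cup product `H¹(X, ℂ)^{k+1} → H^{k+1}(X, ℂ)` as a multilinear map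

* `Universe.cupPowC X k` — the `ℂ`-multilinear map `(v₀, …, v_k) ↦ v₀ ∪ ⋯ ∪ v_k` on `H¹(X, ℂ) = ℂ ⊗ H¹(X, ℚ)`
  (left bracketing, `cupPowC X (k+1) v = cupC (cupPowC X k (init v)) (v last)`), the base change of `cupPow`;
* `cupPowC_ofRat`, `pullC_cupPowC` (M2 `Fact_pull_cup`), `conj_cupC`;
* from `CupExterior X k` (`⋀^{k+1} H¹ ≅ H^{k+1}` via cup, fact N1 for `X = A′`): `span_cupPowC_eq_top` (the monomials
  span `H^{k+1}(X, ℂ)`), `cupPowC_swap` / `cupPowC_eq_zero_of_eq` (alternation over `ℂ`, transferred from `ℚ` by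
  comparing the two multilinear maps on the basis `1 ⊗ b_i`, `Module.Basis.ext_multilinear`), and
  `cupPowC_mem_span_comp` (monomials in any spanning family span).
No new hypotheses; no placeholders.
-/

noncomputable section

open scoped TensorProduct

namespace HodgeCM

open Literature.AlgebraicGeometry.Motives
open Literature.AlgebraicGeometry.Motives.HodgeStructure (conj ofRat conj_tmul conj_conj ofRat_apply)

namespace Universe

variable {U : Universe}

/-! ### `cupC`: conjugation, rational classes, relation to `cup2C` -/

/-- (Ported verbatim from the HodgeCMPerL package; no docstring in the source.) -/
theorem conj_cupC (X : U.Var) (i j : ℕ) (x : U.CohC X i) (y : U.CohC X j) :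
    conj (U.cupC X i j x y) = U.cupC X i j (conj x) (conj y) := by
  induction x using TensorProduct.induction_on with
  | zero => simp
  | add x x' hx hx' => simp only [map_add, LinearMap.add_apply, hx, hx']
  | tmul a x =>
    induction y using TensorProduct.induction_on with
    | zero => simp
    | add y y' hy hy' => simp only [map_add, hy, hy']
    | tmul b y => simp only [cupC_tmul, conj_tmul, map_mul]

/-- (Ported verbatim from the HodgeCMPerL package; no docstring in the source.) -/
theorem cupC_ofRat (X : U.Var) (i j : ℕ) (x : U.Coh X i) (y : U.Coh X j) :
    U.cupC X i j (ofRat x) (ofRat y) = ofRat (U.cup X i j x y) := by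
  rw [ofRat_apply, ofRat_apply, ofRat_apply, cupC_tmul, mul_one]

/-- `cup2C` is the equal-degree case of `cupC`. -/
theorem cup2C_eq_cupC (X : U.Var) (k : ℕ) (x y : U.CohC X k) : U.cup2C X k x y = U.cupC X k k x y := by
  induction x using TensorProduct.induction_on with
  | zero => simp
  | add x x' hx hx' => simp only [map_add, LinearMap.add_apply, hx, hx']
  | tmul a x =>
    induction y using TensorProduct.induction_on with
    | zero => simp
    | add y y' hy hy' => simp only [map_add, hy, hy']
    | tmul b y => simp only [cupC_tmul, cup2C_tmul]

/-- Consistency: the all-degree fact N2 `Fact_cup_hodge` implies M4 `Fact_cup2_hodge`. -/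
theorem cup2_hodge_of_cup_hodge (h : U.Fact_cup_hodge) : U.Fact_cup2_hodge := by
  intro X k p q x y hx hy
  rw [cup2C_eq_cupC]
  exact h X k k p q x y hx hy

/-! ### The multilinear iterated cup product -/

variable (U) in
/-- `cupPowC X k (v₀, …, v_k) = v₀ ∪ ⋯ ∪ v_k ∈ H^{k+1}(X, ℂ)` (left bracketing), as a `ℂ`-multilinear map. -/
def cupPowC (X : U.Var) : (k : ℕ) → MultilinearMap ℂ (fun _ : Fin (k + 1) => U.CohC X 1) (U.CohC X (k + 1))
  | 0 => MultilinearMap.ofSubsingleton ℂ (U.CohC X 1) (U.CohC X 1) (0 : Fin 1) LinearMap.id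
  | k + 1 => MultilinearMap.uncurryRight (M := fun _ : Fin (k + 2) => U.CohC X 1)
      ((U.cupC X (k + 1) 1).compMultilinearMap (cupPowC X k))

/-- (Ported verbatim from the HodgeCMPerL package; no docstring in the source.) -/
@[simp] theorem cupPowC_zero_apply (X : U.Var) (v : Fin 1 → U.CohC X 1) : U.cupPowC X 0 v = v 0 := rfl

/-- (Ported verbatim from the HodgeCMPerL package; no docstring in the source.) -/
theorem cupPowC_succ_apply (X : U.Var) (k : ℕ) (v : Fin (k + 2) → U.CohC X 1) :
    U.cupPowC X (k + 1) v = U.cupC X (k + 1) 1 (U.cupPowC X k (Fin.init v)) (v (Fin.last (k + 1))) := rfl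

/-- `cupPowC` is the base change of `cupPow`: on rational classes it is `cupPow`. -/
theorem cupPowC_ofRat (X : U.Var) : ∀ (k : ℕ) (a : Fin (k + 1) → U.Coh X 1),
    U.cupPowC X k (fun i => ofRat (a i)) = ofRat (U.cupPow X k a)
  | 0, _ => rfl
  | k + 1, a => by
    rw [cupPowC_succ_apply, cupPow_succ, ← cupC_ofRat, ← cupPowC_ofRat X k (Fin.init a)]
    rfl

/-- `f^*(v₀ ∪ ⋯ ∪ v_k) = f^*v₀ ∪ ⋯ ∪ f^*v_k` (M2 `Fact_pull_cup`). -/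
theorem pullC_cupPowC (hcup : U.Fact_pull_cup) {X Y : U.Var} (f : U.Mor X Y) : ∀ (k : ℕ) (v : Fin (k + 1) → U.CohC Y 1),
    U.pullC f (k + 1) (U.cupPowC Y k v) = U.cupPowC X k (fun i => U.pullC f 1 (v i))
  | 0, _ => rfl
  | k + 1, v => by
    rw [cupPowC_succ_apply, cupPowC_succ_apply, U.pullC_cupC hcup, pullC_cupPowC hcup f k]
    rfl

/-! ### Consequences of `CupExterior X k` (`⋀^{k+1} H¹ ≅ H^{k+1}` via the cup product) -/

section Exterior

variable {X : U.Var} {k : ℕ}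

/-- The rational monomials `a₀ ∪ ⋯ ∪ a_k` span `H^{k+1}(X, ℚ)`. -/
theorem span_cupPow_eq_top (h : U.CupExterior X k) : Submodule.span ℚ (Set.range (U.cupPow X k)) = ⊤ := by
  obtain ⟨e, he, hcomp⟩ := h
  have hr : Set.range (U.cupPow X k) = e '' Set.range (exteriorPower.ιMulti ℚ (k + 1) (M := U.Coh X 1)) := by
    rw [← Set.range_comp]
    exact congrArg Set.range (funext fun a => (hcomp a).symm)
  rw [hr, Submodule.span_image, exteriorPower.ιMulti_span, Submodule.map_top, LinearMap.range_eq_top.2 he.2]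

/-- Skew-symmetry of `a ↦ a₀ ∪ ⋯ ∪ a_k` over `ℚ`. -/
theorem cupPow_swap (h : U.CupExterior X k) (a : Fin (k + 1) → U.Coh X 1) {i l : Fin (k + 1)} (hil : i ≠ l) :
    U.cupPow X k (a ∘ Equiv.swap i l) = -U.cupPow X k a := by
  obtain ⟨e, -, hcomp⟩ := h
  rw [← hcomp, ← hcomp, (exteriorPower.ιMulti ℚ (k + 1)).map_swap a hil, map_neg]

/-- The complex monomials `v₀ ∪ ⋯ ∪ v_k` span `H^{k+1}(X, ℂ)`. -/
theorem span_cupPowC_eq_top (h : U.CupExterior X k) :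
    Submodule.span ℂ (Set.range (U.cupPowC X k)) = ⊤ := by
  have key : ∀ w : U.Coh X (k + 1), ((1 : ℂ) ⊗ₜ[ℚ] w : U.CohC X (k + 1)) ∈
      Submodule.span ℂ (Set.range (U.cupPowC X k)) := by
    intro w
    have hw : w ∈ Submodule.span ℚ (Set.range (U.cupPow X k)) := by rw [span_cupPow_eq_top h]; trivial
    induction hw using Submodule.span_induction with
    | mem w hw =>
      obtain ⟨a, rfl⟩ := hw
      have : ((1 : ℂ) ⊗ₜ[ℚ] U.cupPow X k a : U.CohC X (k + 1)) = U.cupPowC X k (fun i => ofRat (a i)) := by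
        rw [cupPowC_ofRat]; rfl
      rw [this]
      exact Submodule.subset_span ⟨_, rfl⟩
    | zero => simp
    | add w w' _ _ h h' => simpa only [TensorProduct.tmul_add] using add_mem h h'
    | smul r w _ h =>
      rw [TensorProduct.tmul_smul, ← algebraMap_smul ℂ r]
      exact Submodule.smul_mem _ _ h
  rw [eq_top_iff]
  rintro t -
  induction t using TensorProduct.induction_on with
  | zero => exact zero_mem _
  | add t t' h h' => exact add_mem h h'
  | tmul c w =>
    have : c ⊗ₜ[ℚ] w = c • ((1 : ℂ) ⊗ₜ[ℚ] w) := by rw [TensorProduct.smul_tmul', smul_eq_mul, mul_one]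
    rw [this]
    exact Submodule.smul_mem _ c (key w)

/-- Skew-symmetry of `v ↦ v₀ ∪ ⋯ ∪ v_k` over `ℂ`: the two multilinear maps `v ↦ cupPowC (v ∘ swap)` and
`v ↦ -cupPowC v` agree on the basis families `(1 ⊗ b_{w(0)}, …, 1 ⊗ b_{w(k)})` by `cupPow_swap`. -/
theorem cupPowC_swap (h : U.CupExterior X k) (v : Fin (k + 1) → U.CohC X 1) {i l : Fin (k + 1)} (hil : i ≠ l) :
    U.cupPowC X k (v ∘ Equiv.swap i l) = -U.cupPowC X k v := by
  let b := Module.Free.chooseBasis ℚ (U.Coh X 1)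
  let bC := Algebra.TensorProduct.basis ℂ b
  suffices hfg : (U.cupPowC X k).domDomCongr (Equiv.swap i l) = -U.cupPowC X k by
    have := congrArg (fun f : MultilinearMap ℂ (fun _ : Fin (k + 1) => U.CohC X 1) (U.CohC X (k + 1)) => f v) hfg
    rw [MultilinearMap.domDomCongr_apply, neg_apply] at this
    exact this
  refine Module.Basis.ext_multilinear (fun _ => bC) fun w => ?_
  have h1 : (fun m => bC (w (Equiv.swap i l m))) = fun m => ofRat (((⇑b ∘ w) ∘ ⇑(Equiv.swap i l)) m) := by
    funext m; simp [bC, Algebra.TensorProduct.basis_apply, ofRat_apply]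
  have h2 : (fun m => bC (w m)) = fun m => ofRat ((⇑b ∘ w) m) := by
    funext m; simp [bC, Algebra.TensorProduct.basis_apply, ofRat_apply]
  rw [MultilinearMap.domDomCongr_apply, neg_apply, h1, h2, cupPowC_ofRat, cupPowC_ofRat,
    cupPow_swap h _ hil, map_neg]

/-- Alternation: a monomial with two equal entries vanishes. -/
theorem cupPowC_eq_zero_of_eq (h : U.CupExterior X k) (v : Fin (k + 1) → U.CohC X 1) {i l : Fin (k + 1)}
    (hil : i ≠ l) (hv : v i = v l) : U.cupPowC X k v = 0 := by
  have hs : v ∘ Equiv.swap i l = v := by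
    funext m
    simp only [Function.comp_apply]
    rcases eq_or_ne m i with rfl | hmi
    · rw [Equiv.swap_apply_left, hv]
    rcases eq_or_ne m l with rfl | hml
    · rw [Equiv.swap_apply_right, hv]
    · rw [Equiv.swap_apply_of_ne_of_ne hmi hml]
  have h2 := cupPowC_swap h v hil
  rw [hs] at h2
  have h3 : (2 : ℂ) • U.cupPowC X k v = 0 := by
    rw [two_smul]
    nth_rewrite 1 [h2]
    exact neg_add_cancel _
  exact (smul_eq_zero.mp h3).resolve_left two_ne_zero

end Exterior

/-! ### Monomials in a spanning family span -/

section SpanComp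

variable {X : U.Var} {L : Type*} (u : L → U.CohC X 1)

/-- If `u : L → H¹(X, ℂ)` spans, every monomial `v₀ ∪ ⋯ ∪ v_k` is a combination of the monomials
`u_{p 0} ∪ ⋯ ∪ u_{p k}`, `p : Fin (k+1) → L` (multilinearity). -/
theorem cupPowC_mem_span_comp (hu : Submodule.span ℂ (Set.range u) = ⊤) : ∀ (k : ℕ) (v : Fin (k + 1) → U.CohC X 1),
    U.cupPowC X k v ∈ Submodule.span ℂ (Set.range fun p : Fin (k + 1) → L => U.cupPowC X k (u ∘ p))
  | 0, v => by
    have hv : v 0 ∈ Submodule.span ℂ (Set.range u) := by rw [hu]; trivial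
    rw [cupPowC_zero_apply]
    refine Submodule.span_mono ?_ hv
    rintro _ ⟨l, rfl⟩
    exact ⟨fun _ => l, rfl⟩
  | k + 1, v => by
    have hA := cupPowC_mem_span_comp hu k (Fin.init v)
    have hB : v (Fin.last (k + 1)) ∈ Submodule.span ℂ (Set.range u) := by rw [hu]; trivial
    have hAB := Submodule.apply_mem_map₂ (U.cupC X (k + 1) 1) hA hB
    rw [Submodule.map₂_span_span] at hAB
    rw [cupPowC_succ_apply]
    refine Submodule.span_mono ?_ hAB
    rintro _ ⟨_, ⟨p, rfl⟩, _, ⟨l, rfl⟩, rfl⟩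
    refine ⟨Fin.snoc p l, ?_⟩
    have e1 : Fin.init (u ∘ Fin.snoc p l) = u ∘ p := by
      funext i; simp [Fin.init, Fin.snoc_castSucc]
    have e2 : (u ∘ Fin.snoc p l) (Fin.last (k + 1)) = u l := by simp [Fin.snoc_last]
    simp only [cupPowC_succ_apply, e1, e2]

/-- Hence, if `⋀^{k+1} H¹ ≅ H^{k+1}` via cup and `u` spans `H¹(X, ℂ)`, the monomials in the `u`'s span `H^{k+1}(X, ℂ)`. -/
theorem span_cupPowC_comp_eq_top {k : ℕ} (h : U.CupExterior X k) (hu : Submodule.span ℂ (Set.range u) = ⊤) :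
    Submodule.span ℂ (Set.range fun p : Fin (k + 1) → L => U.cupPowC X k (u ∘ p)) = ⊤ := by
  rw [eq_top_iff, ← span_cupPowC_eq_top h, Submodule.span_le]
  rintro _ ⟨v, rfl⟩
  exact cupPowC_mem_span_comp u hu k v

end SpanComp

/-! ### Scalars pulled out of every slot -/

/-- (Ported verbatim from the HodgeCMPerL package; no docstring in the source.) -/
theorem cupPowC_smul (X : U.Var) (k : ℕ) (c : Fin (k + 1) → ℂ) (v : Fin (k + 1) → U.CohC X 1) :
    U.cupPowC X k (fun i => c i • v i) = (∏ i, c i) • U.cupPowC X k v :=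
  MultilinearMap.map_smul_univ _ c v

end Universe

end HodgeCM

end
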